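import Mathlib
import Summits.ValiantsHypothesis.ValiantsHypothesis.Theorems.SymmetroidPencilBasics
import Summits.ValiantsHypothesis.ValiantsHypothesis.Theorems.LacunarySymmetroidMatrixDescartesStubPerturbRankOne

/-!
# ValiantsHypothesis / LacunarySymmetroid — crux `MatrixDescartes` (stmt-ValiantsHypothesis-18050),
# line `Cruxes/MatrixDescartes/Lines/sign_split.lean`, stub `stub_perturb` (`PerturbToAlternation`,
# = `lorentzian_shadow`'s `stub_perturbT8`): Jacobi's formula, the generic rank-one direction, and
# **THE STUB PROVED** (unfolded statement)

Helper file (`--supports stmt-ValiantsHypothesis-18050 --as helper`; cell val-lit, seat val-lit-p5 g9, merged desk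
RULING #80).  Closes NO item (the stubs of the lines `sign_split` / `lorentzian_shadow` are not in the item's registry,
so there is no by-name credit; the statement proved below is `SignSplit.PerturbToAlternation` with `pencil`,
`posRootCount`, `Alternates` unfolded verbatim, exactly as `…StubSplit` did for `SplitToSemidefinite`).
«V1 line stub; `MatrixDescartes` / Conjecture B / `VP ≠ VNP` OPEN — nothing here bears on them.»

The last missing piece of the chain `…StubPerturb` → `…Assembly` → `…OddSplit` → `…LocalSplit` → `…RankOne`:
a vector `v` such that `q_v = X^{d_{l₀}} · vᵀ adj(F) v` vanishes at every positive root of even multiplicity of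
`p = det F` to a lower order than `p`.

* **`derivative_det`** — JACOBI'S FORMULA for polynomial matrices: `(det F)' = Σ_{j,a} adj(F)_{j a} · F'_{a j}`
  (Leibniz expansion, `derivative_prod_finset`, Cramer = adjugate);
* `exists_adjugate_not_dvd` — at a root `ρ` of `det F ≠ 0` of multiplicity `μ`, NOT every entry of `adj F` is
  divisible by `(X - ρ)^μ` (else `(X - ρ)^μ ∣ (det F)'`, whose multiplicity at `ρ` is `μ - 1`);
* `exists_iterate_derivative_eval_ne` — non-divisibility by `(X - ρ)^μ` gives a derivative of order `< μ` not
  vanishing at `ρ`;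
* `iterate_derivative_quadForm_eval` — `(vᵀ adj(F) v)^{(k)}(ρ) = Σ_{a,b} v_a v_b (adj F)_{ab}^{(k)}(ρ)`, a real
  quadratic form in `v` with symmetric matrix;
* `quadFormPoly`, `quadFormPoly_ne_zero` — that quadratic form as an `MvPolynomial`, nonzero when its (symmetric)
  matrix is nonzero; a finite product of nonzero polynomials has a non-root (`MvPolynomial.funext`), whence
  **`exists_generic_direction`**: ONE `v` good at every root in a finite set;
* **`perturbToAlternation`** — `PerturbToAlternation` (unfolded): if every symmetric pencil of format `(d, m)` has at
  most `B` strict sign alternations of its determinant along positive points, then every symmetric pencil of that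
  format has at most `2B` distinct positive roots.
-/

set_option linter.dupNamespace false

namespace Summit.ValiantsHypothesis.ValiantsHypothesis.Theorems.LacunarySymmetroidMatrixDescartes

open Polynomial Finset Matrix
open Summit.ValiantsHypothesis.ValiantsHypothesis.Theorems.SymmetroidDescartes
  (eval_det_pencil card_filter_roots_det_sum_fin_zero)

namespace Perturb

/-! ## 1. Jacobi's formula -/

/-- **Jacobi's formula** for a square matrix of polynomials: `(det F)' = Σ_j Σ_a adj(F)_{j a} · (F_{a j})'`
(`= tr (adj F · F')`). -/
theorem derivative_det {n : Type*} [Fintype n] [DecidableEq n] (F : Matrix n n ℝ[X]) :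
    derivative F.det = ∑ j, ∑ a, F.adjugate j a * derivative (F a j) := by
  -- Leibniz expansion of det (F with column j replaced by its derivative)
  have hupd : ∀ j : n, (F.updateCol j fun a => derivative (F a j)).det =
      ∑ σ : Equiv.Perm n, ((Equiv.Perm.sign σ : ℤ) : ℝ[X]) *
        ((∏ i ∈ Finset.univ.erase j, F (σ i) i) * derivative (F (σ j) j)) := by
    intro j
    rw [Matrix.det_apply']
    refine Finset.sum_congr rfl fun σ _ => ?_
    congr 1
    rw [← Finset.prod_erase_mul _ _ (Finset.mem_univ j), updateCol_self]
    congr 1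
    exact Finset.prod_congr rfl fun i hi => by rw [updateCol_ne (Finset.ne_of_mem_erase hi)]
  -- Cramer: that determinant is a row of the adjugate against the derivative column
  have hcr : ∀ j : n, (F.updateCol j fun a => derivative (F a j)).det =
      ∑ a, F.adjugate j a * derivative (F a j) := by
    intro j
    rw [← cramer_apply, cramer_eq_adjugate_mulVec]
    simp [Matrix.mulVec, dotProduct]
  calc derivative F.det
      = ∑ σ : Equiv.Perm n, ((Equiv.Perm.sign σ : ℤ) : ℝ[X]) *
          ∑ j, (∏ i ∈ Finset.univ.erase j, F (σ i) i) * derivative (F (σ j) j) := by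
        rw [Matrix.det_apply', map_sum]
        refine Finset.sum_congr rfl fun σ _ => ?_
        rw [derivative_intCast_mul, derivative_prod_finset]
    _ = ∑ j, ∑ σ : Equiv.Perm n, ((Equiv.Perm.sign σ : ℤ) : ℝ[X]) *
          ((∏ i ∈ Finset.univ.erase j, F (σ i) i) * derivative (F (σ j) j)) := by
        rw [Finset.sum_comm]
        exact Finset.sum_congr rfl fun σ _ => Finset.mul_sum _ _ _
    _ = ∑ j, ∑ a, F.adjugate j a * derivative (F a j) :=
        Finset.sum_congr rfl fun j _ => by rw [← hupd, hcr]

/-! ## 2. Orders of vanishing of the adjugate -/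

/-- At a root `ρ` of `det F ≠ 0` of multiplicity `μ`, some entry of `adj F` is NOT divisible by `(X - ρ)^μ`. -/
theorem exists_adjugate_not_dvd {n : Type*} [Fintype n] [DecidableEq n] (F : Matrix n n ℝ[X])
    (hF : F.det ≠ 0) (ρ : ℝ) (hroot : F.det.IsRoot ρ) :
    ∃ a b : n, ¬ (X - C ρ) ^ (F.det.rootMultiplicity ρ) ∣ F.adjugate a b := by
  by_contra h
  simp only [not_exists, not_not] at h
  have hdvd : (X - C ρ) ^ (F.det.rootMultiplicity ρ) ∣ derivative F.det := by
    rw [derivative_det]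
    exact Finset.dvd_sum fun j _ => Finset.dvd_sum fun a _ => Dvd.dvd.mul_right (h j a) _
  have hder : derivative F.det ≠ 0 := by
    intro h0
    have hc : F.det = C (F.det.coeff 0) := eq_C_of_natDegree_eq_zero (Polynomial.derivative_eq_zero.mp h0)
    have h0c : F.det.coeff 0 = 0 := by
      have := hroot
      rw [hc] at this
      simpa using this
    exact hF (by rw [hc, h0c, map_zero])
  have h1 := (Polynomial.le_rootMultiplicity_iff hder).mpr hdvd
  rw [Polynomial.derivative_rootMultiplicity_of_root hroot] at h1
  have h2 := (Polynomial.rootMultiplicity_pos hF).mpr hroot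
  omega

/-- Non-divisibility by `(X - ρ)^μ` exhibits a derivative of order `< μ` not vanishing at `ρ`. -/
theorem exists_iterate_derivative_eval_ne {f : ℝ[X]} {ρ : ℝ} {μ : ℕ} (h : ¬ (X - C ρ) ^ μ ∣ f) :
    ∃ k, k < μ ∧ (derivative^[k] f).eval ρ ≠ 0 := by
  have hf : f ≠ 0 := by rintro rfl; exact h (dvd_zero _)
  have hlt : f.rootMultiplicity ρ < μ := by
    by_contra hle
    exact h ((Polynomial.le_rootMultiplicity_iff hf).mp (not_lt.mp hle))
  have hnot : ¬ ∀ m ≤ f.rootMultiplicity ρ, (derivative^[m] f).IsRoot ρ := fun hall =>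
    lt_irrefl _ ((Polynomial.lt_rootMultiplicity_iff_isRoot_iterate_derivative hf).mpr hall)
  obtain ⟨m, hm⟩ := not_forall.mp hnot
  obtain ⟨hmle, hmr⟩ := Classical.not_imp.mp hm
  exact ⟨m, by omega, hmr⟩

/-- A derivative of order `k` not vanishing at `ρ` bounds the root multiplicity by `k`. -/
theorem rootMultiplicity_le_of_iterate_derivative_eval_ne {f : ℝ[X]} {ρ : ℝ} {k : ℕ}
    (h : (derivative^[k] f).eval ρ ≠ 0) : f ≠ 0 ∧ f.rootMultiplicity ρ ≤ k := by
  have hf : f ≠ 0 := by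
    rintro rfl
    simp [iterate_map_zero] at h
  refine ⟨hf, ?_⟩
  by_contra hlt
  exact h ((Polynomial.lt_rootMultiplicity_iff_isRoot_iterate_derivative hf).mp (not_le.mp hlt) k le_rfl)

/-! ## 3. The adjugate quadratic form along a direction -/

/-- Derivatives of the adjugate form `vᵀ G v` at a point are real quadratic forms in `v`. -/
theorem iterate_derivative_quadForm_eval {m : ℕ} (G : Matrix (Fin m) (Fin m) ℝ[X]) (v : Fin m → ℝ)
    (k : ℕ) (ρ : ℝ) :
    (derivative^[k] ((fun i => C (v i)) ⬝ᵥ (G *ᵥ fun i => C (v i)))).eval ρ =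
      ∑ a, ∑ b, v a * v b * (derivative^[k] (G a b)).eval ρ := by
  have hrw : ((fun i => C (v i)) ⬝ᵥ (G *ᵥ fun i => C (v i))) =
      ∑ a, ∑ b, C (v a * v b) * G a b := by
    simp only [dotProduct, Matrix.mulVec, Finset.mul_sum]
    refine Finset.sum_congr rfl fun a _ => Finset.sum_congr rfl fun b _ => ?_
    rw [map_mul]; ring
  rw [hrw, iterate_derivative_sum, eval_finsetSum]
  refine Finset.sum_congr rfl fun a _ => ?_
  rw [iterate_derivative_sum, eval_finsetSum]
  refine Finset.sum_congr rfl fun b _ => ?_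
  rw [iterate_derivative_C_mul, eval_mul, eval_C]

/-- The quadratic form `v ↦ Σ_{a,b} L_{ab} v_a v_b` as a polynomial in the coordinates of `v`. -/
noncomputable def quadFormPoly {m : ℕ} (L : Matrix (Fin m) (Fin m) ℝ) : MvPolynomial (Fin m) ℝ :=
  ∑ a, ∑ b, MvPolynomial.C (L a b) * MvPolynomial.X a * MvPolynomial.X b

/-- Evaluating `quadFormPoly L` at `v` gives `Σ_{a,b} v_a v_b L_{ab}`. -/
theorem eval_quadFormPoly {m : ℕ} (L : Matrix (Fin m) (Fin m) ℝ) (v : Fin m → ℝ) :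
    MvPolynomial.eval v (quadFormPoly L) = ∑ a, ∑ b, v a * v b * L a b := by
  simp only [quadFormPoly, map_sum, map_mul, MvPolynomial.eval_C, MvPolynomial.eval_X]
  refine Finset.sum_congr rfl fun a _ => Finset.sum_congr rfl fun b _ => ?_
  ring

/-- A nonzero SYMMETRIC matrix has a nonzero quadratic form polynomial. -/
theorem quadFormPoly_ne_zero {m : ℕ} (L : Matrix (Fin m) (Fin m) ℝ) (hL : L.IsSymm) (a₀ b₀ : Fin m)
    (h : L a₀ b₀ ≠ 0) : quadFormPoly L ≠ 0 := by
  classical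
  -- values on coordinate vectors and their sums
  have hsingle : ∀ c : Fin m, MvPolynomial.eval (Pi.single c (1 : ℝ)) (quadFormPoly L) = L c c := by
    intro c
    rw [eval_quadFormPoly]
    simp [Pi.single_apply, Finset.sum_ite_eq']
  have hpair : ∀ c e : Fin m, c ≠ e →
      MvPolynomial.eval (Pi.single c (1 : ℝ) + Pi.single e 1) (quadFormPoly L) =
        L c c + L c e + (L e c + L e e) := by
    intro c e hce
    rw [eval_quadFormPoly]
    simp [Pi.single_apply, Finset.sum_add_distrib, add_mul, mul_add, Finset.sum_ite_eq']
    ring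
  intro hzero
  by_cases hdiag : L a₀ a₀ ≠ 0
  · have := hsingle a₀
    rw [hzero, map_zero] at this
    exact hdiag this.symm
  by_cases hdiag' : L b₀ b₀ ≠ 0
  · have := hsingle b₀
    rw [hzero, map_zero] at this
    exact hdiag' this.symm
  have hne : a₀ ≠ b₀ := by
    intro hab; subst hab; exact hdiag h
  have hsym : L b₀ a₀ = L a₀ b₀ := by
    have := congrFun (congrFun hL a₀) b₀
    simpa [Matrix.transpose_apply] using this
  have := hpair a₀ b₀ hne
  rw [hzero, map_zero, not_not.mp hdiag, not_not.mp hdiag', hsym] at this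
  have : L a₀ b₀ = 0 := by linarith
  exact h this

/-- A nonzero polynomial over `ℝ` has a non-root. -/
theorem exists_eval_ne_zero {m : ℕ} (P : MvPolynomial (Fin m) ℝ) (hP : P ≠ 0) :
    ∃ v : Fin m → ℝ, MvPolynomial.eval v P ≠ 0 := by
  by_contra h
  simp only [not_exists, not_not] at h
  exact hP (MvPolynomial.funext fun v => by rw [h v, map_zero])

/-- **One generic direction for finitely many roots.**  For a SYMMETRIC square matrix `F` of real polynomials with
`det F ≠ 0` and a finite set `R` of roots of `det F`, some `v` makes the adjugate form `vᵀ adj(F) v` nonzero with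
root multiplicity `< mult_ρ (det F)` at every `ρ ∈ R`. -/
theorem exists_generic_direction {m : ℕ} (F : Matrix (Fin m) (Fin m) ℝ[X]) (hFs : Fᵀ = F) (hF : F.det ≠ 0)
    (R : Finset ℝ) (hR : ∀ ρ ∈ R, F.det.IsRoot ρ) :
    ∃ v : Fin m → ℝ, ∀ ρ ∈ R,
      ((fun i => C (v i)) ⬝ᵥ (F.adjugate *ᵥ fun i => C (v i))) ≠ 0 ∧
        ((fun i => C (v i)) ⬝ᵥ (F.adjugate *ᵥ fun i => C (v i))).rootMultiplicity ρ <
          F.det.rootMultiplicity ρ := by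
  classical
  have hadj : (F.adjugate)ᵀ = F.adjugate := by rw [adjugate_transpose, hFs]
  -- per root: an order k_ρ < μ_ρ and the symmetric real matrix of k_ρ-th derivatives at ρ, nonzero
  have hstep : ∀ ρ ∈ R, ∃ k : ℕ, k < F.det.rootMultiplicity ρ ∧
      quadFormPoly (fun a b => (derivative^[k] (F.adjugate a b)).eval ρ) ≠ 0 := by
    intro ρ hρ
    obtain ⟨a, b, hab⟩ := exists_adjugate_not_dvd F hF ρ (hR ρ hρ)
    obtain ⟨k, hk, hne⟩ := exists_iterate_derivative_eval_ne hab
    refine ⟨k, hk, quadFormPoly_ne_zero _ ?_ a b hne⟩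
    ext a' b'
    simp only [Matrix.transpose_apply]
    rw [show F.adjugate b' a' = F.adjugate a' b' from by
      have := congrFun (congrFun hadj a') b'; simpa [Matrix.transpose_apply] using this]
  choose! k hk hq using hstep
  -- a common non-root of the finitely many quadratic forms
  set Ψ := ∏ ρ ∈ R, quadFormPoly (fun a b => (derivative^[k ρ] (F.adjugate a b)).eval ρ) with hΨ
  have hΨne : Ψ ≠ 0 := Finset.prod_ne_zero_iff.mpr fun ρ hρ => hq ρ hρ
  obtain ⟨v, hv⟩ := exists_eval_ne_zero Ψ hΨne
  rw [hΨ, map_prod] at hv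
  refine ⟨v, fun ρ hρ => ?_⟩
  have hvρ := Finset.prod_ne_zero_iff.mp hv ρ hρ
  rw [eval_quadFormPoly] at hvρ
  -- that value is the k_ρ-th derivative of the adjugate form at ρ
  have hder : (derivative^[k ρ] ((fun i => C (v i)) ⬝ᵥ (F.adjugate *ᵥ fun i => C (v i)))).eval ρ ≠ 0 := by
    rw [iterate_derivative_quadForm_eval]; exact hvρ
  obtain ⟨hne, hle⟩ := rootMultiplicity_le_of_iterate_derivative_eval_ne hder
  exact ⟨hne, lt_of_le_of_lt hle (hk ρ hρ)⟩

/-! ## 4. The stub -/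

/-- The lacunary pencil of a symmetric family is a symmetric polynomial matrix. -/
theorem transpose_pencil {K m : ℕ} (d : Fin K → ℕ) (S : Fin K → Matrix (Fin m) (Fin m) ℝ)
    (hS : ∀ l, (S l).IsSymm) :
    (∑ l, (Polynomial.X : ℝ[X]) ^ d l • (S l).map Polynomial.C)ᵀ =
      ∑ l, (Polynomial.X : ℝ[X]) ^ d l • (S l).map Polynomial.C := by
  rw [Matrix.transpose_sum]
  refine Finset.sum_congr rfl fun l _ => ?_
  rw [Matrix.transpose_smul, ← Matrix.transpose_map, (hS l).eq]

/-- **`PerturbToAlternation` (line `sign_split`, = `lorentzian_shadow`'s `stub_perturbT8`), statement unfolded.**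
If every symmetric lacunary pencil `Σ_l X^{d_l} S_l` of format `(d, m)` has at most `B` strict sign alternations of its
determinant along positive points, then every symmetric pencil of that format has at most `2B` distinct positive
roots.  Proof: odd-multiplicity roots alternate (`…StubPerturb`/`…OddSplit`); even-multiplicity roots split under the
rank-one perturbation `S_{l₀} ↦ S_{l₀} ± ε v vᵀ` of ONE coefficient in ONE generic direction `v`
(`…RankOne`, `…LocalSplit`, `exists_generic_direction`); the chains are assembled and counted per sign
(`…Assembly`). -/
theorem perturbToAlternation :
    ∀ (K m : ℕ) (d : Fin K → ℕ) (B : ℕ),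
      (∀ S : Fin K → Matrix (Fin m) (Fin m) ℝ, (∀ l, (S l).IsSymm) →
        ∀ (N : ℕ) (τ : Fin (N + 1) → ℝ),
          (StrictMono τ ∧ (∀ j, 0 < τ j) ∧ ∀ j : Fin N,
            (∑ l, (Polynomial.X : ℝ[X]) ^ d l • (S l).map Polynomial.C).det.eval (τ j.castSucc) *
              (∑ l, (Polynomial.X : ℝ[X]) ^ d l • (S l).map Polynomial.C).det.eval (τ j.succ) < 0) → N ≤ B) →
      ∀ S : Fin K → Matrix (Fin m) (Fin m) ℝ, (∀ l, (S l).IsSymm) →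
        ((∑ l, (Polynomial.X : ℝ[X]) ^ d l • (S l).map Polynomial.C).det.roots.toFinset.filter
          fun t => 0 < t).card ≤ 2 * B := by
  intro K m d B H S hS
  classical
  rcases Nat.eq_zero_or_pos K with hK | hK
  · subst hK
    rw [card_filter_roots_det_sum_fin_zero]
    exact Nat.zero_le _
  set F := ∑ l, (Polynomial.X : ℝ[X]) ^ d l • (S l).map Polynomial.C with hFdef
  by_cases hp : F.det = 0
  · simp [hp]
  set l₀ : Fin K := ⟨0, hK⟩
  set R := F.det.roots.toFinset.filter fun t => 0 < t with hRdef
  have hRroot : ∀ ρ ∈ R, F.det.IsRoot ρ := fun ρ hρ =>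
    (Polynomial.mem_roots hp).mp (Multiset.mem_toFinset.mp (Finset.mem_filter.mp hρ).1)
  obtain ⟨v, hv⟩ := exists_generic_direction F (transpose_pencil d S hS) hp R hRroot
  rcases R.eq_empty_or_nonempty with hR | ⟨ρ₀, hρ₀⟩
  · rw [hR, Finset.card_empty]; exact Nat.zero_le _
  refine posRootCount_le_of_adjOrder K m d B H S hS l₀ v
    (mul_ne_zero (pow_ne_zero _ Polynomial.X_ne_zero) (hv ρ₀ hρ₀).1) fun ρ hρ _ => ?_
  have hρpos : 0 < ρ := (Finset.mem_filter.mp hρ).2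
  obtain ⟨hne, hlt⟩ := hv ρ hρ
  have hX : ((Polynomial.X : ℝ[X]) ^ d l₀).rootMultiplicity ρ = 0 :=
    Polynomial.rootMultiplicity_eq_zero (by simp [Polynomial.IsRoot, hρpos.ne'])
  rw [Polynomial.rootMultiplicity_mul (mul_ne_zero (pow_ne_zero _ Polynomial.X_ne_zero) hne), hX, zero_add]
  exact hlt

end Perturb

end Summit.ValiantsHypothesis.ValiantsHypothesis.Theorems.LacunarySymmetroidMatrixDescartes
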